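import Summits.Ventures.CertifiedManyBodySolver.Downfold.EmeryReferenceLevel
import HarnessLib

/-!
# Monotonicity of the three-band variational energy in the site energies and repulsions, and the
# LOWER-FACE vertex rule: 4 instead of 64 vertex certificates bind a delivered Emery box

Venture CertifiedManyBodySolver, cell `pub/hubbard-downfold` (stage S1 = ROUTER), seat hubbard-downfold-mod-4;
namespace `Summit.Ventures.CertifiedManyBodySolver.Downfold`. Sequel of `Downfold.S2SeamEmery` (door 2: a floor
certified at the `2⁶ = 64` vertices of the delivered six-box `(t_pd, t_pp, ε_d, ε_p, U_d, U_p)` is a box word)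
and `Downfold.EmeryReferenceLevel` (cell energies of the site-energy directions). For the decorated `CuO₂` model of
record (`EmeryThreeBandByDecoration`, hubbard-box-p1) the conjugate densities of the six directions
`8, 9, 10` (site energies: `¼ ×` a sublattice density) and `11, 12, 13` (repulsions: `¼ ×` a sublattice double
occupancy) are NON-NEGATIVE in every state, so the variational energy density is NON-DECREASING in
`(ε_d, ε_p, U_d, U_p)`. Consequently the minimum of the (concave) energy over a delivered box sits on its LOWER
FACE in those four coordinates, and an S2 producer needs vertex certificates only at the `2² = 4` corners
`(t_pd, t_pp) ∈ {lo, hi}²` with `(ε_d, ε_p, U_d, U_p)` at their lower ends — a 16-fold saving, proved here.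

* §1 generic (`viewFamily` over any class): `infCellEnergyOn_viewFamily_mono` — if every direction in which `θ'`
  exceeds `θ` has a non-negative cell energy on the class (and the others agree), `e_S(θ) ≤ e_S(θ')`.
* §2 Emery: `cellEnergy_sublatticeOnSiteViews_zero_one` (repulsion views: `|C|⁻¹ ×` double occupancy at the
  representative), `cellEnergy_emeryDirections_nonneg_of_ge_8` (directions `8…13` have `0 ≤` cell energy in every
  state), `emeryEnergyDensity_mono_upper` (`θ ≤ θ'` on `8…13`, `=` on `0…7` ⇒ `e(θ, ρ) ≤ e(θ', ρ)`).
* §3 the line: `emeryEnergyDensity_line_mono_tail` — raising any of `(ε_d, ε_p, U_d, U_p)` raises `e`;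
  `lowerFace lo hi = (hi₀, hi₁, lo₂, lo₃, lo₄, lo₅)`; **`le_emeryEnergyDensity_line_of_lowerFace`** — floors at
  the vertices of `Set.Icc lo (lowerFace lo hi)` (the 4 lower-face corners) bind the whole box `Set.Icc lo hi`;
  **`holdsOn_emeryEnergyFloor_lowerFace`** — the same as a box word of a typed `EmeryBox` through the seam.

Everything here is PROVED; no number about a material. HONEST SCOPE: energy words of the decorated model only; the
hopping coordinates `t_pd, t_pp` keep both ends (no sign-definiteness of bond energies is claimed).
-/

noncomputable section

namespace Summit.Ventures.CertifiedManyBodySolver.Downfold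

open Matrix Finset Literature.Probability.LatticeModels
open Literature.MathematicalPhysics.QuantumLattice Literature.Computation.Certificates
open scoped BigOperators

/-! ## §1 Generic: monotone directions of a view family -/

section Generic

variable {d : ℕ} {q : Fin d → ℕ} {ι : Type*} [Fintype ι]

/-- **Monotone directions.** If `θ ≤ θ'` coordinatewise and every direction `a` with `θ a < θ' a` — indeed every
direction — has a NON-NEGATIVE cell energy on the class wherever `θ' a ≠ θ a`, then the variational cell energy
is monotone: `e_S(M(θ)) ≤ e_S(M(θ'))`. (Empty class: both sides are `0`.) [cite: KomaTasaki1994, §1] -/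
theorem infCellEnergyOn_viewFamily_mono (S : Set (InfVolFermionState d)) (M₀ : Cell q → FermionInteraction d)
    (D : ι → Cell q → FermionInteraction d) (R : ℝ) {θ θ' : ι → ℝ} (hle : θ ≤ θ')
    (hD : ∀ ω ∈ S, ∀ a, θ a ≠ θ' a → 0 ≤ ω.cellEnergy (D a) R) :
    infCellEnergyOn S (viewFamily M₀ D θ) R ≤ infCellEnergyOn S (viewFamily M₀ D θ') R := by
  rcases S.eq_empty_or_nonempty with hS | hS
  · rw [hS, infCellEnergyOn_empty, infCellEnergyOn_empty]
  refine le_infCellEnergyOn _ R hS fun ω hω => ?_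
  rw [ω.cellEnergy_viewFamily_eq_add_sum_sub_mul M₀ D θ' θ R]
  have hsum : 0 ≤ ∑ a, (θ' a - θ a) * ω.cellEnergy (D a) R := by
    refine Finset.sum_nonneg fun a _ => ?_
    by_cases h : θ a = θ' a
    · rw [h, sub_self, zero_mul]
    · exact mul_nonneg (sub_nonneg.2 (hle a)) (hD ω hω a h)
  have hinf := infCellEnergyOn_le_cellEnergy (viewFamily M₀ D θ) R hω
  linarith

end Generic

/-! ## §2 The decorated `CuO₂` model: directions `8…13` have non-negative conjugate densities -/

/-- **Cell energy of the unit REPULSION views on coset `c`** (`ε = 0`, `U = 1`): `|C|⁻¹ ×` the double occupancy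
`Re ω∘τ(n↑ n↓)` at the cell representative of `c`. [cite: BratteliKishimotoRobinson1978, §3 (mean energy functional)] -/
theorem cellEnergy_sublatticeOnSiteViews_zero_one {d : ℕ} (q : Fin d → ℕ) (c : Site d) (R : ℝ)
    (ω : InfVolFermionState d) :
    ω.cellEnergy (sublatticeOnSiteViews q c 0 1) R =
      (Fintype.card (Cell q) : ℝ)⁻¹ *
        ((ω.shift (cellPos (cellRep q c))).expect {0}
          (nAt (0 : Site d) (Finset.mem_singleton_self 0) 0 *
            nAt 0 (Finset.mem_singleton_self 0) 1)).re := by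
  rw [InfVolFermionState.cellEnergy]
  congr 1
  have h : ∀ n : Cell q, (ω.shift (cellPos n)).meanEnergy (sublatticeOnSiteViews q c 0 1 n) R =
      if InCoset q (c - cellPos n) 0 then
        ((ω.shift (cellPos n)).expect {0}
          (nAt (0 : Site d) (Finset.mem_singleton_self 0) 0 *
            nAt 0 (Finset.mem_singleton_self 0) 1)).re else 0 := fun n => by
    rw [sublatticeOnSiteViews, InfVolFermionState.meanEnergy_sublatticeOnSite]
    by_cases hc : InCoset q (c - cellPos n) 0
    · rw [if_pos hc, if_pos hc, zero_mul, one_mul, zero_add]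
    · rw [if_neg hc, if_neg hc]
  simp_rw [h]
  exact sum_ite_inCoset_sub_cellPos q c (fun n => ((ω.shift (cellPos n)).expect {0}
    (nAt (0 : Site d) (Finset.mem_singleton_self 0) 0 *
      nAt 0 (Finset.mem_singleton_self 0) 1)).re)

/-- The Cu repulsion direction (`a = 11`) has non-negative cell energy in every state. [cite: BratteliRobinsonI1987, §2.3.2] -/
theorem cellEnergy_emeryDirections_11_nonneg (ω : InfVolFermionState 2) : 0 ≤ ω.cellEnergy (emeryDirections 11) 1 := by
  have h : emeryDirections 11 = sublatticeOnSiteViews liebPeriods cuSite 0 1 := rfl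
  rw [h, cellEnergy_sublatticeOnSiteViews_zero_one]
  exact mul_nonneg (inv_nonneg.2 (Nat.cast_nonneg _)) (InfVolFermionState.re_expect_docc_nonneg _)

/-- The `O_x` repulsion direction (`a = 12`) has non-negative cell energy. [cite: BratteliRobinsonI1987, §2.3.2] -/
theorem cellEnergy_emeryDirections_12_nonneg (ω : InfVolFermionState 2) : 0 ≤ ω.cellEnergy (emeryDirections 12) 1 := by
  have h : emeryDirections 12 = sublatticeOnSiteViews liebPeriods oxSite 0 1 := rfl
  rw [h, cellEnergy_sublatticeOnSiteViews_zero_one]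
  exact mul_nonneg (inv_nonneg.2 (Nat.cast_nonneg _)) (InfVolFermionState.re_expect_docc_nonneg _)

/-- The `O_y` repulsion direction (`a = 13`) has non-negative cell energy. [cite: BratteliRobinsonI1987, §2.3.2] -/
theorem cellEnergy_emeryDirections_13_nonneg (ω : InfVolFermionState 2) : 0 ≤ ω.cellEnergy (emeryDirections 13) 1 := by
  have h : emeryDirections 13 = sublatticeOnSiteViews liebPeriods oySite 0 1 := rfl
  rw [h, cellEnergy_sublatticeOnSiteViews_zero_one]
  exact mul_nonneg (inv_nonneg.2 (Nat.cast_nonneg _)) (InfVolFermionState.re_expect_docc_nonneg _)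

/-- The Cu site-energy direction (`a = 8`) has non-negative cell energy (`¼ ×` a density). [cite: ArakiMoriya2003, §4.1] -/
theorem cellEnergy_emeryDirections_8_nonneg (ω : InfVolFermionState 2) : 0 ≤ ω.cellEnergy (emeryDirections 8) 1 := by
  rw [cellEnergy_emeryDirections_8]
  exact mul_nonneg (by norm_num) (InfVolFermionState.density_nonneg _)

/-- The `O_x` site-energy direction (`a = 9`) has non-negative cell energy. [cite: ArakiMoriya2003, §4.1] -/
theorem cellEnergy_emeryDirections_9_nonneg (ω : InfVolFermionState 2) : 0 ≤ ω.cellEnergy (emeryDirections 9) 1 := by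
  rw [cellEnergy_emeryDirections_9]
  exact mul_nonneg (by norm_num) (InfVolFermionState.density_nonneg _)

/-- The `O_y` site-energy direction (`a = 10`) has non-negative cell energy. [cite: ArakiMoriya2003, §4.1] -/
theorem cellEnergy_emeryDirections_10_nonneg (ω : InfVolFermionState 2) : 0 ≤ ω.cellEnergy (emeryDirections 10) 1 := by
  rw [cellEnergy_emeryDirections_10]
  exact mul_nonneg (by norm_num) (InfVolFermionState.density_nonneg _)

/-- **Directions `8…13` of the decorated model have non-negative conjugate densities in every state.**
[cite: ArakiMoriya2003, §4.1] -/
theorem cellEnergy_emeryDirections_nonneg_of_ge_8 (ω : InfVolFermionState 2) {a : Fin 14} (ha : 8 ≤ a.val) :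
    0 ≤ ω.cellEnergy (emeryDirections a) 1 := by
  have hlt := a.isLt
  have : a = 8 ∨ a = 9 ∨ a = 10 ∨ a = 11 ∨ a = 12 ∨ a = 13 := by
    rcases a with ⟨v, hv⟩
    simp only [Fin.ext_iff]
    simp only at ha
    omega
  rcases this with h | h | h | h | h | h <;> subst h
  · exact cellEnergy_emeryDirections_8_nonneg ω
  · exact cellEnergy_emeryDirections_9_nonneg ω
  · exact cellEnergy_emeryDirections_10_nonneg ω
  · exact cellEnergy_emeryDirections_11_nonneg ω
  · exact cellEnergy_emeryDirections_12_nonneg ω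
  · exact cellEnergy_emeryDirections_13_nonneg ω

/-- **The three-band variational energy is NON-DECREASING in the site energies and repulsions**: if `θ ≤ θ'`
coordinatewise and they agree on the eight hopping directions `0…7`, then `e(θ, ρ) ≤ e(θ', ρ)`.
[cite: KomaTasaki1994, §1] -/
theorem emeryEnergyDensity_mono_upper (ρ : ℝ) {θ θ' : Fin 14 → ℝ} (hle : θ ≤ θ')
    (hhop : ∀ a : Fin 14, a.val < 8 → θ a = θ' a) :
    emeryEnergyDensity θ ρ ≤ emeryEnergyDensity θ' ρ := by
  rw [emeryEnergyDensity, emeryEnergyDensity, emeryViews, emeryViews]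
  refine infCellEnergyOn_viewFamily_mono _ _ emeryDirections 1 hle fun ω _ a hne => ?_
  have ha : 8 ≤ a.val := by
    by_contra h
    exact hne (hhop a (by omega))
  exact cellEnergy_emeryDirections_nonneg_of_ge_8 ω ha

/-! ## §3 The physical line and the lower-face vertex rule -/

/-- **Raising any of `(ε_d, ε_p, U_d, U_p)` raises the energy along the physical line**: for `q ≤ q'` agreeing
on `(t_pd, t_pp)`, `e(emeryLine s q, ρ) ≤ e(emeryLine s q', ρ)`. [cite: KomaTasaki1994, §1] -/
theorem emeryEnergyDensity_line_mono_tail (s : Fin 4 → ℝ) (ρ : ℝ) {q q' : Fin 6 → ℝ} (hle : q ≤ q')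
    (h0 : q 0 = q' 0) (h1 : q 1 = q' 1) :
    emeryEnergyDensity (emeryLine s q) ρ ≤ emeryEnergyDensity (emeryLine s q') ρ := by
  refine emeryEnergyDensity_mono_upper ρ (fun a => ?_) (fun a ha => ?_)
  · fin_cases a <;> simp [emeryLine, h0, h1, hle 2, hle 3, hle 4, hle 5]
  · have : a = 0 ∨ a = 1 ∨ a = 2 ∨ a = 3 ∨ a = 4 ∨ a = 5 ∨ a = 6 ∨ a = 7 := by
      rcases a with ⟨v, hv⟩
      simp only [Fin.ext_iff]
      simp only at ha
      omega
    rcases this with h | h | h | h | h | h | h | h <;> subst h <;> simp [emeryLine, h0, h1]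

/-- **The lower face** of a six-box in S2's order: full range in `(t_pd, t_pp)`, lower ends in
`(ε_d, ε_p, U_d, U_p)`: `lowerFace lo hi = (hi₀, hi₁, lo₂, lo₃, lo₄, lo₅)`. [folklore] -/
def lowerFace (lo hi : Fin 6 → ℝ) : Fin 6 → ℝ := ![hi 0, hi 1, lo 2, lo 3, lo 4, lo 5]

/-- The lower-face projection of a point of the box: `(q₀, q₁, lo₂, lo₃, lo₄, lo₅)`. [folklore] -/
def lowerProj (lo q : Fin 6 → ℝ) : Fin 6 → ℝ := ![q 0, q 1, lo 2, lo 3, lo 4, lo 5]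

/-- The projection lies below the point (for a point of the box). [folklore] -/
theorem lowerProj_le {lo hi q : Fin 6 → ℝ} (hq : q ∈ Set.Icc lo hi) : lowerProj lo q ≤ q := by
  intro k
  fin_cases k <;> simp [lowerProj, hq.1 2, hq.1 3, hq.1 4, hq.1 5]

/-- The projection lies in the lower face `Set.Icc lo (lowerFace lo hi)`. [folklore] -/
theorem lowerProj_mem {lo hi q : Fin 6 → ℝ} (hq : q ∈ Set.Icc lo hi) :
    lowerProj lo q ∈ Set.Icc lo (lowerFace lo hi) := by
  rw [Set.mem_Icc, Pi.le_def, Pi.le_def]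
  refine ⟨fun k => ?_, fun k => ?_⟩ <;> fin_cases k <;> simp [lowerProj, lowerFace, hq.1 0, hq.1 1, hq.2 0, hq.2 1]

/-- **THE LOWER-FACE VERTEX RULE (16-fold saving).** Floors certified at the vertices of the lower face
`Set.Icc lo (lowerFace lo hi)` — i.e. at the `4` corners `(t_pd, t_pp) ∈ {lo₀, hi₀} × {lo₁, hi₁}` with
`(ε_d, ε_p, U_d, U_p) = (lo₂, lo₃, lo₄, lo₅)` — hold on the WHOLE six-box `Set.Icc lo hi` (concavity along
the line on the face, then monotonicity in the four tail coordinates). [cite: Israel1979, Thm. I.3.4] -/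
theorem le_emeryEnergyDensity_line_of_lowerFace (s : Fin 4 → ℝ) (ρ : ℝ) (lo hi : Fin 6 → ℝ) {m : ℝ}
    (hm : ∀ v ∈ Fintype.piFinset (fun k => ({lo k, lowerFace lo hi k} : Finset ℝ)),
      m ≤ emeryEnergyDensity (emeryLine s v) ρ)
    {q : Fin 6 → ℝ} (hq : q ∈ Set.Icc lo hi) : m ≤ emeryEnergyDensity (emeryLine s q) ρ := by
  have h1 : m ≤ emeryEnergyDensity (emeryLine s (lowerProj lo q)) ρ :=
    le_emeryEnergyDensity_line_of_mem_Icc s ρ lo (lowerFace lo hi) hm (lowerProj_mem hq)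
  have h2 : emeryEnergyDensity (emeryLine s (lowerProj lo q)) ρ ≤ emeryEnergyDensity (emeryLine s q) ρ :=
    emeryEnergyDensity_line_mono_tail s ρ (lowerProj_le hq) (by simp [lowerProj]) (by simp [lowerProj])
  exact h1.trans h2

/-- **Lower-face floors are box words of a typed Emery box** (through the seam `emeryLineCoords`, reference
level `εp`): certificates at the 4 lower-face corners of the delivered box of `E` give
`m ≤ e(emeryLine s (emeryLineCoords εp p), ρ)` for every parameter vector `p` of `E`. [cite: Israel1979, Thm. I.3.4] -/
theorem holdsOn_emeryEnergyFloor_lowerFace {E : EmeryBox} {eA eB eD eUd eUp : Entry} {εp : ℚ}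
    (hA : E .tpd = some eA) (hB : E .tpp = some eB) (hD : E .DeltaPd = some eD)
    (hUd : E .Udd = some eUd) (hUp : E .Upp = some eUp) (s : Fin 4 → ℝ) (ρ : ℝ) {m : ℝ}
    (hm : ∀ v ∈ Fintype.piFinset (fun k => ({emeryLo εp eA eB eD eUd eUp k,
        lowerFace (emeryLo εp eA eB eD eUd eUp) (emeryHi εp eA eB eD eUd eUp) k} : Finset ℝ)),
      m ≤ emeryEnergyDensity (emeryLine s v) ρ) :
    HoldsOn (fun p : EmeryCoord → ℝ =>
      m ≤ emeryEnergyDensity (emeryLine s (emeryLineCoords (εp : ℝ) p)) ρ) E :=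
  holdsOn_of_forall_emeryLineBox hA hB hD hUd hUp
    (fun _ hq => le_emeryEnergyDensity_line_of_lowerFace s ρ _ _ hm hq)

end Summit.Ventures.CertifiedManyBodySolver.Downfold

end
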